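import Summits.CriticalPhenomena.PercolationContinuityZ3.Theorems.PercAnnulusCrossingIICRooted
import HarnessLib

/-!
# The IIC rooted at a connected set and conditioned off an arbitrary finite set of CLOSED EDGES (lane RSW3, p1 gen 8)

builds on p205010 (kernel theorem, internal audit signed; external expert review pending) — NOT used in this file.

RSW3 lane (LANE 3 `prim-rsw3`), seat `prim-rsw3-p1` (gen 8).  Helper file (`--supports stmt-CriticalPhenomena-4575`); no definitions, no sorries;
every `d`, every `p`.  `…IICRooted` deletes a set of VERTICES `H` (all lattice edges at `H` closed).  Here the obstacle is an ARBITRARY finite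
set `F` of pairs (to be closed) and the root `X ∋ 0` is connected through an arbitrary finite set `G` of pairs inside `X` (to be open); with
`K = F ∪ G`, `C_K = {F closed, G open}`, `φ ω = (ω ∖ F) ∪ G` and
`CONN_F(X;n) = {ω | ∃ x ∈ X, x ↔ ∂ⁱⁿΛ(n) in Λ(n) in the configuration ω ∖ F}` (an arm from `X` NOT USING the edges of `F`):

* `mem_connOff_iff_map_mem_arm` — `ω ∈ CONN_F(X;n) ⟺ φ ω ∈ A_n` (purely combinatorial; every `ω`, no lattice hypothesis);
* **`real_inter_connOff_mul_real_cyl_eq`** — `P_p(E ∩ CONN_F(X;n)) · P_p(C_K) = P_p(E ∩ C_K ∩ A_n)` for every measurable `E` determined off `K`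
  (exact, every `p`, every `n` with `X ⊆ Λ(n)`); in particular `P_p(CONN_F(X;n)) · P_p(C_K) = P_p(C_K ∩ A_n)`;
* **`tendsto_real_connOff_div_oneArmProb`**, **`tendsto_real_inter_connOff_div_real_connOff`** — for `ν` with Kesten's IIC limit property:
  `P_p(CONN_F(X;n))/π_p(n) → ν(C_K)/P_p(C_K)` and `P_p(E | CONN_F(X;n)) → ν(E ∩ C_K)/ν(C_K)`.
* §4 APPLICATION — `connOff_union_eq_connOff` (forbidding pairs inside the root changes nothing), `determinedBy_connOff`, `measurableSet_connOff`,
  `clusterBox_inter_siteToBoundary_eq` (on 'the cluster of `0` in `Λ(m)` is `V`', the arm is the arm from `V` using no pair at `V` inside `Λ(m)`),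
  **`iicMeasure_real_clusterBox_mul_eq`: `ν(CL_m(V)) · P_p(C) = P_p(CL_m(V)) · ν(C)`** with `CL_m(V) = {pairs V → Λ(m)∖V closed} ∩ {0 ↔ v in V ∀ v ∈ V}`
  and `C = {pairs V → Λ(m)∖V closed, internal lattice edges of V open}` — THE `ν`-LAW OF THE CLUSTER OF THE ORIGIN IN A BOX IS THE `P_p`-LAW TILTED
  BY THE IIC CAPACITY `c_m(V) = ν(C)/P_p(C) = lim_n P_p(V ↔ ∂ⁱⁿΛ(n) using no pair at V inside Λ(m))/π_p(n)`.
References: H. Kesten, PTRF 73 (1986) Thm (3); D. Basu, A. Sapozhnikov, ECP 22 (2017) no. 26, Thm 1.1; G. Grimmett, *Percolation* (1999), §2.2.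
-/

noncomputable section

namespace Summit.CriticalPhenomena.PercolationContinuityZ3.Theorems.Crossing

open MeasureTheory Filter Topology Literature.Probability.Percolation Literature.Probability.LatticeModels
open Literature.Probability.Percolation.DCT16

variable {d : ℕ}

/-! ## §1 The configuration identity -/

/-- **Arm from `X` not using `F` ⟺ arm from `x₀` after the overwrite `φ ω = (ω ∖ F) ∪ G`**, for `X ∋ x₀` connected through the pairs `G`
(all inside `X`) and `X ⊆ Λ(n)`; every configuration `ω`. [cite: Kesten1986, §2 (2.16)] -/
theorem mem_connOff_iff_map_mem_arm {X : Finset (Site d)} {F G : Finset (Sym2 (Site d))} (hG : ∀ e ∈ G, ∀ v ∈ e, v ∈ X)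
    {x₀ : Site d} (hX0 : x₀ ∈ X) (hXconn : ∀ x ∈ X, PathIn (openGraph (↑G : Set (Sym2 (Site d)))) (↑X : Set (Site d)) x₀ x)
    {n : ℕ} (hXn : X ⊆ box d n) (ω : BondConfig (Site d)) :
    ω ∈ {ω : BondConfig (Site d) | ∃ x ∈ X, ∃ t ∈ innerBoundary (zdGraph d) (box d n),
        ω \ (↑F : Set (Sym2 (Site d))) ∈ openConnIn (↑(box d n) : Set (Site d)) x t} ↔
      ω \ (↑F : Set (Sym2 (Site d))) ∪ ↑G ∈ {ω : BondConfig (Site d) | ∃ t ∈ innerBoundary (zdGraph d) (box d n),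
        ω ∈ openConnIn (↑(box d n) : Set (Site d)) x₀ t} := by
  classical
  set ψ : BondConfig (Site d) := ω \ (↑F : Set (Sym2 (Site d))) ∪ ↑G with hψ
  have hmono : ∀ a b : Site d, (openGraph (ω \ (↑F : Set (Sym2 (Site d))))).Adj a b → (openGraph ψ).Adj a b := by
    intro a b hab
    rw [openGraph_adj] at hab ⊢
    exact ⟨Or.inl hab.1, hab.2⟩
  have hGψ : ∀ a b : Site d, (openGraph (↑G : Set (Sym2 (Site d)))).Adj a b → (openGraph ψ).Adj a b := by
    intro a b hab
    rw [openGraph_adj] at hab ⊢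
    exact ⟨Or.inr hab.1, hab.2⟩
  have hback : ∀ a b : Site d, b ∉ X → (openGraph ψ).Adj a b → (openGraph (ω \ (↑F : Set (Sym2 (Site d))))).Adj a b := by
    intro a b hb hab
    rw [openGraph_adj] at hab ⊢
    obtain ⟨hmem, hne⟩ := hab
    rcases hmem with h | heG
    · exact ⟨h, hne⟩
    · exact absurd (hG _ (Finset.mem_coe.1 heG) b (Sym2.mem_mk_right a b)) hb
  have hXn' : (↑X : Set (Site d)) ⊆ ↑(box d n) := Finset.coe_subset.2 hXn
  constructor
  · rintro ⟨x, hx, t, ht, hxt⟩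
    have hP : PathIn (openGraph ψ) (↑(box d n) : Set (Site d)) x t :=
      pathIn_map (f := id) (fun a ha => ha) (fun a b _ _ hab => hmono a b hab) (pathIn_of_mem_openConnIn hxt)
    have hQ : PathIn (openGraph ψ) (↑(box d n) : Set (Site d)) x₀ x :=
      pathIn_map (f := id) (fun a ha => hXn' ha) (fun a b _ _ hab => hGψ a b hab) (hXconn x hx)
    exact ⟨t, ht, mem_openConnIn_of_pathIn (hQ.trans hP)⟩
  · rintro ⟨t, ht, h0t⟩
    have hP := pathIn_of_mem_openConnIn h0t
    by_cases htX : t ∈ X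
    · exact ⟨t, htX, t, ht, mem_openConnIn_of_pathIn (PathIn.refl (Finset.mem_coe.2 (hXn htX)))⟩
    obtain ⟨a, b, haX, han, hbX, hab, hrest⟩ := hP.last_exit (C := (↑X : Set (Site d))) (Finset.mem_coe.2 hX0)
      (fun h' => htX (Finset.mem_coe.1 h'))
    have hseg : PathIn (openGraph (ω \ (↑F : Set (Sym2 (Site d))))) (↑(box d n) : Set (Site d)) b t :=
      pathIn_transfer hrest hrest.left_mem.1 fun c e _ he _ hce => ⟨he.1, hback c e he.2 hce⟩
    exact ⟨a, Finset.mem_coe.1 haX, t, ht, mem_openConnIn_of_pathIn ((PathIn.of_adj han hseg.left_mem (hback a b hbX hab)).trans hseg)⟩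

/-! ## §2 The identity -/

/-- **`P_p(E ∩ CONN_F(X;n)) · P_p(C_K) = P_p(E ∩ C_K ∩ {0 ↔ ∂ⁱⁿΛ(n)})`** for `X ∋ 0` connected through `G` (pairs inside `X`), `X ⊆ Λ(n)`, an
arbitrary finite set `F` of pairs, and every measurable `E` determined by a set of pairs disjoint from `K = F ∪ G` — rooting Kesten's conditioning at
`X` while forbidding the edges of `F` is conditioning on the cylinder `C_K = {F closed, G open}`.  Exact, every `p`, every `d`.
[cite: Kesten1986, §2 (2.16)–(2.22)] [cite: BasuSapozhnikov2017ECP, §2 (2.8)] -/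
theorem real_inter_connOff_mul_real_cyl_eq (p : unitInterval) {X : Finset (Site d)} {F G : Finset (Sym2 (Site d))}
    (hG : ∀ e ∈ G, ∀ v ∈ e, v ∈ X) (hX0 : (0 : Site d) ∈ X)
    (hXconn : ∀ x ∈ X, PathIn (openGraph (↑G : Set (Sym2 (Site d)))) (↑X : Set (Site d)) 0 x)
    {n : ℕ} (hXn : X ⊆ box d n) {E : Set (BondConfig (Site d))} (hEm : MeasurableSet E) {T : Set (Sym2 (Site d))} (hE : DeterminedBy E T)
    (hT : Disjoint T ↑(F ∪ G)) :
    (bondPercolation (zdGraph d) p).real (E ∩ {ω : BondConfig (Site d) | ∃ x ∈ X, ∃ t ∈ innerBoundary (zdGraph d) (box d n),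
        ω \ (↑F : Set (Sym2 (Site d))) ∈ openConnIn (↑(box d n) : Set (Site d)) x t}) *
        (bondPercolation (zdGraph d) p).real {ω : BondConfig (Site d) | (∀ e ∈ F, e ∉ ω) ∧ ∀ e ∈ G, e ∈ ω} =
      (bondPercolation (zdGraph d) p).real (E ∩ {ω : BondConfig (Site d) | (∀ e ∈ F, e ∉ ω) ∧ ∀ e ∈ G, e ∈ ω} ∩ siteToBoundary d n) := by
  classical
  set μ := bondPercolation (zdGraph d) p with hμ
  set φ : BondConfig (Site d) → BondConfig (Site d) := fun ω => ω \ (↑F : Set (Sym2 (Site d))) ∪ ↑G with hφ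
  -- `E` is `φ`-invariant
  have hEφ : ∀ ω, ω ∈ E ↔ φ ω ∈ E := by
    intro ω
    refine (determinedBy_iff _ _).1 hE ω (φ ω) ?_
    ext e
    simp only [hφ, Set.mem_inter_iff, Set.mem_union, Set.mem_sdiff, Finset.mem_coe]
    constructor
    · rintro ⟨he, heT⟩
      have heK : e ∉ F ∪ G := fun h' => Set.disjoint_left.1 hT heT (Finset.mem_coe.2 h')
      rw [Finset.mem_union, not_or] at heK
      exact ⟨Or.inl ⟨he, heK.1⟩, heT⟩
    · rintro ⟨h, heT⟩
      have heK : e ∉ F ∪ G := fun h' => Set.disjoint_left.1 hT heT (Finset.mem_coe.2 h')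
      rw [Finset.mem_union, not_or] at heK
      rcases h with ⟨he, -⟩ | heG
      · exact ⟨he, heT⟩
      · exact absurd heG heK.2
  -- `E ∩ CONN_F = φ⁻¹(E ∩ A_n)` (as sets)
  have h1 : E ∩ {ω : BondConfig (Site d) | ∃ x ∈ X, ∃ t ∈ innerBoundary (zdGraph d) (box d n),
      ω \ (↑F : Set (Sym2 (Site d))) ∈ openConnIn (↑(box d n) : Set (Site d)) x t} = φ ⁻¹' (E ∩ siteToBoundary d n) := by
    ext ω
    rw [Set.mem_preimage, Set.mem_inter_iff, Set.mem_inter_iff, ← hEφ ω, mem_connOff_iff_map_mem_arm hG hX0 hXconn hXn ω]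
    rfl
  rw [h1, real_preimage_map_mul_real_cyl p F G (hEm.inter (measurableSet_siteToBoundary d n))]
  congr 1
  ext ω; simp only [Set.mem_inter_iff]; tauto

/-- **`P_p(CONN_F(X;n)) · P_p(C_K) = P_p(C_K ∩ {0 ↔ ∂ⁱⁿΛ(n)})`** (the case `E = univ`). [cite: Kesten1986, §2 (2.16)] -/
theorem real_connOff_mul_real_cyl_eq (p : unitInterval) {X : Finset (Site d)} {F G : Finset (Sym2 (Site d))}
    (hG : ∀ e ∈ G, ∀ v ∈ e, v ∈ X) (hX0 : (0 : Site d) ∈ X)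
    (hXconn : ∀ x ∈ X, PathIn (openGraph (↑G : Set (Sym2 (Site d)))) (↑X : Set (Site d)) 0 x) {n : ℕ} (hXn : X ⊆ box d n) :
    (bondPercolation (zdGraph d) p).real {ω : BondConfig (Site d) | ∃ x ∈ X, ∃ t ∈ innerBoundary (zdGraph d) (box d n),
        ω \ (↑F : Set (Sym2 (Site d))) ∈ openConnIn (↑(box d n) : Set (Site d)) x t} *
        (bondPercolation (zdGraph d) p).real {ω : BondConfig (Site d) | (∀ e ∈ F, e ∉ ω) ∧ ∀ e ∈ G, e ∈ ω} =
      (bondPercolation (zdGraph d) p).real ({ω : BondConfig (Site d) | (∀ e ∈ F, e ∉ ω) ∧ ∀ e ∈ G, e ∈ ω} ∩ siteToBoundary d n) := by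
  have h := real_inter_connOff_mul_real_cyl_eq p (F := F) hG hX0 hXconn hXn MeasurableSet.univ (T := ∅)
    ((determinedBy_iff _ _).2 fun ω ω' _ => by simp) (by simp)
  rwa [Set.univ_inter, Set.univ_inter] at h

/-! ## §3 The limits -/

/-- **`P_p(∃ x ∈ X, x ↔ ∂ⁱⁿΛ(n) not using F)/π_p(n) → ν(C_K)/P_p(C_K)`** for every measure `ν` with Kesten's IIC limit property at `p`, `X ∋ 0`
connected through `G`, `F` an arbitrary finite set of pairs, `P_p(C_K) > 0`. [cite: Kesten1986, Thm. (3)] [cite: BasuSapozhnikov2017ECP, Thm. 1.1] -/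
theorem tendsto_real_connOff_div_oneArmProb (p : unitInterval) {ν : Measure (BondConfig (Site d))}
    (hν : ∀ (F : Finset (Sym2 (Site d))) (E : Set (BondConfig (Site d))), MeasurableSet E → DeterminedBy E ↑F →
      Tendsto (fun n : ℕ => (bondPercolation (zdGraph d) p).real (E ∩ siteToBoundary d n) / oneArmProb d p n)
        atTop (𝓝 (ν.real E)))
    {X : Finset (Site d)} {F G : Finset (Sym2 (Site d))} (hG : ∀ e ∈ G, ∀ v ∈ e, v ∈ X) (hX0 : (0 : Site d) ∈ X)
    (hXconn : ∀ x ∈ X, PathIn (openGraph (↑G : Set (Sym2 (Site d)))) (↑X : Set (Site d)) 0 x) {m : ℕ} (hXm : X ⊆ box d m)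
    (hC : 0 < (bondPercolation (zdGraph d) p).real {ω : BondConfig (Site d) | (∀ e ∈ F, e ∉ ω) ∧ ∀ e ∈ G, e ∈ ω}) :
    Tendsto (fun n : ℕ => (bondPercolation (zdGraph d) p).real {ω : BondConfig (Site d) | ∃ x ∈ X,
        ∃ t ∈ innerBoundary (zdGraph d) (box d n), ω \ (↑F : Set (Sym2 (Site d))) ∈ openConnIn (↑(box d n) : Set (Site d)) x t} /
        oneArmProb d p n)
      atTop (𝓝 (ν.real {ω : BondConfig (Site d) | (∀ e ∈ F, e ∉ ω) ∧ ∀ e ∈ G, e ∈ ω} /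
        (bondPercolation (zdGraph d) p).real {ω : BondConfig (Site d) | (∀ e ∈ F, e ∉ ω) ∧ ∀ e ∈ G, e ∈ ω})) := by
  classical
  set μ := bondPercolation (zdGraph d) p with hμ
  have hlim := hν (F ∪ G) _ (determinedBy_cyl F G).measurableSet_of_finset (determinedBy_cyl F G)
  refine (hlim.div_const (μ.real {ω : BondConfig (Site d) | (∀ e ∈ F, e ∉ ω) ∧ ∀ e ∈ G, e ∈ ω})).congr' ?_
  filter_upwards [eventually_ge_atTop m] with n hn
  rw [← real_connOff_mul_real_cyl_eq p hG hX0 hXconn (hXm.trans (box_mono d hn)), div_right_comm, mul_div_assoc,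
    div_self hC.ne', mul_one]

/-- **The IIC rooted at `X` with the edges of `F` forbidden is `ν(· | C_K)`**: `P_p(E | ∃ x ∈ X, x ↔ ∂ⁱⁿΛ(n) not using F) → ν(E ∩ C_K)/ν(C_K)` for
every `E` determined by a finite set of pairs disjoint from `K`, every measure `ν` with Kesten's IIC limit property (`0 < p`, `d ≥ 1`), when
`P_p(C_K), ν(C_K) > 0`. [cite: Kesten1986, Thm. (3)] [cite: BasuSapozhnikov2017ECP, Thm. 1.1] -/
theorem tendsto_real_inter_connOff_div_real_connOff (hd : 1 ≤ d) (p : unitInterval) (hp : 0 < (p : ℝ))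
    {ν : Measure (BondConfig (Site d))}
    (hν : ∀ (F : Finset (Sym2 (Site d))) (E : Set (BondConfig (Site d))), MeasurableSet E → DeterminedBy E ↑F →
      Tendsto (fun n : ℕ => (bondPercolation (zdGraph d) p).real (E ∩ siteToBoundary d n) / oneArmProb d p n)
        atTop (𝓝 (ν.real E)))
    {X : Finset (Site d)} {F G : Finset (Sym2 (Site d))} (hG : ∀ e ∈ G, ∀ v ∈ e, v ∈ X) (hX0 : (0 : Site d) ∈ X)
    (hXconn : ∀ x ∈ X, PathIn (openGraph (↑G : Set (Sym2 (Site d)))) (↑X : Set (Site d)) 0 x) {m : ℕ} (hXm : X ⊆ box d m)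
    (hC : 0 < (bondPercolation (zdGraph d) p).real {ω : BondConfig (Site d) | (∀ e ∈ F, e ∉ ω) ∧ ∀ e ∈ G, e ∈ ω})
    (hνC : 0 < ν.real {ω : BondConfig (Site d) | (∀ e ∈ F, e ∉ ω) ∧ ∀ e ∈ G, e ∈ ω})
    {E : Set (BondConfig (Site d))} {T : Finset (Sym2 (Site d))} (hE : DeterminedBy E ↑T) (hT : Disjoint T (F ∪ G)) :
    Tendsto (fun n : ℕ => (bondPercolation (zdGraph d) p).real (E ∩ {ω : BondConfig (Site d) | ∃ x ∈ X,
        ∃ t ∈ innerBoundary (zdGraph d) (box d n), ω \ (↑F : Set (Sym2 (Site d))) ∈ openConnIn (↑(box d n) : Set (Site d)) x t}) /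
        (bondPercolation (zdGraph d) p).real {ω : BondConfig (Site d) | ∃ x ∈ X,
          ∃ t ∈ innerBoundary (zdGraph d) (box d n), ω \ (↑F : Set (Sym2 (Site d))) ∈ openConnIn (↑(box d n) : Set (Site d)) x t})
      atTop (𝓝 (ν.real (E ∩ {ω : BondConfig (Site d) | (∀ e ∈ F, e ∉ ω) ∧ ∀ e ∈ G, e ∈ ω}) /
        ν.real {ω : BondConfig (Site d) | (∀ e ∈ F, e ∉ ω) ∧ ∀ e ∈ G, e ∈ ω})) := by
  classical
  set μ := bondPercolation (zdGraph d) p with hμ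
  have hπ : ∀ n, 0 < oneArmProb d p n := oneArmProb_pos hd p hp
  have hEC : DeterminedBy (E ∩ {ω : BondConfig (Site d) | (∀ e ∈ F, e ∉ ω) ∧ ∀ e ∈ G, e ∈ ω}) (↑(T ∪ (F ∪ G)) : Set (Sym2 (Site d))) := by
    rw [Finset.coe_union]
    exact (hE.mono Set.subset_union_left).inter ((determinedBy_cyl F G).mono Set.subset_union_right)
  have hnum := hν _ _ hEC.measurableSet_of_finset hEC
  have hden := hν (F ∪ G) _ (determinedBy_cyl F G).measurableSet_of_finset (determinedBy_cyl F G)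
  refine ((hnum.div hden hνC.ne')).congr' ?_
  filter_upwards [eventually_ge_atTop m] with n hn
  have hXn := hXm.trans (box_mono d hn)
  have h1 := real_inter_connOff_mul_real_cyl_eq p hG hX0 hXconn hXn hE.measurableSet_of_finset hE (Finset.disjoint_coe.2 hT)
  have h2 := real_connOff_mul_real_cyl_eq p hG hX0 hXconn hXn (F := F)
  rw [Pi.div_apply, div_div_div_cancel_right₀ (hπ n).ne', ← h1, ← h2, mul_div_mul_right _ _ hC.ne']

/-! ## §4 Application: the law of the cluster of the origin in a box under `ν` -/

/-- Forbidding, in addition, pairs INSIDE the root does not change the arm event off the root: `CONN_{F ∪ S}(V;n) = CONN_F(V;n)` for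
`S ⊆ V.sym2` (take the last visit to `V`). [folklore] -/
theorem connOff_union_eq_connOff {V : Finset (Site d)} {F S : Finset (Sym2 (Site d))} (hS : ∀ e ∈ S, ∀ v ∈ e, v ∈ V) (n : ℕ) :
    {ω : BondConfig (Site d) | ∃ x ∈ V, ∃ t ∈ innerBoundary (zdGraph d) (box d n),
        ω \ (↑(F ∪ S) : Set (Sym2 (Site d))) ∈ openConnIn (↑(box d n) : Set (Site d)) x t} =
      {ω : BondConfig (Site d) | ∃ x ∈ V, ∃ t ∈ innerBoundary (zdGraph d) (box d n),
        ω \ (↑F : Set (Sym2 (Site d))) ∈ openConnIn (↑(box d n) : Set (Site d)) x t} := by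
  classical
  ext ω
  constructor
  · rintro ⟨x, hx, t, ht, hxt⟩
    refine ⟨x, hx, t, ht, openConnIn_mono_config ?_ hxt⟩
    rw [Finset.coe_union]
    exact Set.sdiff_subset_sdiff_right Set.subset_union_left
  · rintro ⟨x, hx, t, ht, hxt⟩
    have hP := pathIn_of_mem_openConnIn hxt
    have hback : ∀ a b : Site d, b ∉ V → (openGraph (ω \ (↑F : Set (Sym2 (Site d))))).Adj a b →
        (openGraph (ω \ (↑(F ∪ S) : Set (Sym2 (Site d))))).Adj a b := by
      intro a b hb hab
      rw [openGraph_adj] at hab ⊢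
      refine ⟨⟨hab.1.1, fun h' => ?_⟩, hab.2⟩
      rw [Finset.coe_union, Set.mem_union] at h'
      rcases h' with h' | h'
      · exact hab.1.2 h'
      · exact hb (hS _ (Finset.mem_coe.1 h') b (Sym2.mem_mk_right a b))
    by_cases htV : t ∈ V
    · exact ⟨t, htV, t, ht, mem_openConnIn_of_pathIn (PathIn.refl hP.right_mem)⟩
    obtain ⟨a, b, haV, han, hbV, hab, hrest⟩ := hP.last_exit (C := (↑V : Set (Site d))) (Finset.mem_coe.2 hx)
      (fun h' => htV (Finset.mem_coe.1 h'))
    have hseg : PathIn (openGraph (ω \ (↑(F ∪ S) : Set (Sym2 (Site d))))) (↑(box d n) : Set (Site d)) b t :=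
      pathIn_transfer hrest hrest.left_mem.1 fun c e _ he _ hce => ⟨he.1, hback c e he.2 hce⟩
    exact ⟨a, Finset.mem_coe.1 haV, t, ht, mem_openConnIn_of_pathIn ((PathIn.of_adj han hseg.left_mem (hback a b hbV hab)).trans hseg)⟩

/-- `CONN_F(V;n)` is determined by the pairs off `F`. [folklore] -/
theorem determinedBy_connOff (V : Finset (Site d)) (F : Finset (Sym2 (Site d))) (n : ℕ) :
    DeterminedBy {ω : BondConfig (Site d) | ∃ x ∈ V, ∃ t ∈ innerBoundary (zdGraph d) (box d n),
        ω \ (↑F : Set (Sym2 (Site d))) ∈ openConnIn (↑(box d n) : Set (Site d)) x t} (↑F : Set (Sym2 (Site d)))ᶜ := by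
  rw [determinedBy_iff]
  intro ω ω' h
  have hdiff : ω \ (↑F : Set (Sym2 (Site d))) = ω' \ ↑F := by
    ext e
    have := (Set.ext_iff.1 h) e
    simp only [Set.mem_inter_iff, Set.mem_compl_iff, Finset.mem_coe, Set.mem_sdiff] at this ⊢
    tauto
  simp only [Set.mem_setOf_eq, hdiff]

/-- `CONN_F(V;n)` is measurable. [folklore] -/
theorem measurableSet_connOff (V : Finset (Site d)) (F : Finset (Sym2 (Site d))) (n : ℕ) :
    MeasurableSet {ω : BondConfig (Site d) | ∃ x ∈ V, ∃ t ∈ innerBoundary (zdGraph d) (box d n),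
        ω \ (↑F : Set (Sym2 (Site d))) ∈ openConnIn (↑(box d n) : Set (Site d)) x t} := by
  classical
  have hmeas : Measurable fun ω : BondConfig (Site d) => ω \ (↑F : Set (Sym2 (Site d))) :=
    measurable_set_iff.2 fun i => (measurable_set_mem i).and measurable_const
  exact hmeas (measurableSet_link (box d n) V (innerBoundary (zdGraph d) (box d n)))

/-- **On 'the cluster of `0` in `Λ(m)` is exactly `V`' the arm to `∂ⁱⁿΛ(n)` (`n > m`) is the arm from `V` that uses no pair from `V` to
`Λ(m) ∖ V` and no pair inside `V`** — an event independent of the cluster pattern.  Here the cluster event is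
`CL_m(V) = {every pair from V to Λ(m) ∖ V is closed} ∩ {0 ↔ v inside V for every v ∈ V}`. [folklore] -/
theorem clusterBox_inter_siteToBoundary_eq {m n : ℕ} (hmn : m < n) {V : Finset (Site d)} (hVm : V ⊆ box d m) (h0 : (0 : Site d) ∈ V)
    {F : Finset (Sym2 (Site d))} (hF : ∀ e, e ∈ F ↔ ∃ a ∈ V, ∃ b ∈ box d m, b ∉ V ∧ e = s(a, b)) :
    ({ω : BondConfig (Site d) | ∀ e ∈ F, e ∉ ω} ∩ {ω | ∀ v ∈ V, ω ∈ openConnIn (↑V : Set (Site d)) 0 v}) ∩ siteToBoundary d n =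
      ({ω : BondConfig (Site d) | ∀ e ∈ F, e ∉ ω} ∩ {ω | ∀ v ∈ V, ω ∈ openConnIn (↑V : Set (Site d)) 0 v}) ∩
        {ω : BondConfig (Site d) | ∃ x ∈ V, ∃ t ∈ innerBoundary (zdGraph d) (box d n),
          ω \ (↑(F ∪ V.sym2) : Set (Sym2 (Site d))) ∈ openConnIn (↑(box d n) : Set (Site d)) x t} := by
  classical
  ext ω
  simp only [Set.mem_inter_iff]
  refine and_congr_right fun hCL => ?_
  obtain ⟨hcl, hconn⟩ := hCL
  have hVn : (↑V : Set (Site d)) ⊆ ↑(box d n) := Finset.coe_subset.2 (hVm.trans (box_mono d hmn.le))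
  constructor
  · rintro ⟨t, ht, h0t⟩
    have hP := pathIn_of_mem_openConnIn h0t
    have htV : t ∉ (↑V : Set (Site d)) := fun h' => notMem_box_of_mem_innerBoundary_box hmn ht (hVm (Finset.mem_coe.1 h'))
    obtain ⟨a, b, haV, han, hbV, hab, hrest⟩ := hP.last_exit (C := (↑V : Set (Site d))) (Finset.mem_coe.2 h0) htV
    -- edges after the last visit to `V` avoid `F ∪ V.sym2`
    have hback : ∀ c e : Site d, c ∈ (↑(box d n) : Set (Site d)) → e ∉ (↑V : Set (Site d)) → (openGraph ω).Adj c e →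
        (openGraph (ω \ (↑(F ∪ V.sym2) : Set (Sym2 (Site d))))).Adj c e := by
      intro c e _ he hce
      rw [openGraph_adj] at hce ⊢
      refine ⟨⟨hce.1, fun h' => ?_⟩, hce.2⟩
      rw [Finset.coe_union, Set.mem_union, Finset.mem_coe, Finset.mem_coe, hF, Finset.mk_mem_sym2_iff] at h'
      rcases h' with ⟨a', ha', b', hb'm, hb'V, hab'⟩ | ⟨-, heV⟩
      · -- `s(c,e) = s(a',b')` with `a' ∈ V`, `b' ∈ Λ(m) ∖ V`: then the pair is closed on `CL`, contradiction
        exact hcl _ ((hF _).2 ⟨a', ha', b', hb'm, hb'V, rfl⟩) (hab' ▸ hce.1)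
      · exact he (Finset.mem_coe.2 heV)
    have hseg : PathIn (openGraph (ω \ (↑(F ∪ V.sym2) : Set (Sym2 (Site d))))) (↑(box d n) : Set (Site d)) b t :=
      pathIn_transfer hrest hrest.left_mem.1 fun c e hc he _ hce => ⟨he.1, hback c e hc.1 he.2 hce⟩
    exact ⟨a, Finset.mem_coe.1 haV, t, ht,
      mem_openConnIn_of_pathIn ((PathIn.of_adj han hseg.left_mem (hback a b han hbV hab)).trans hseg)⟩
  · rintro ⟨x, hx, t, ht, hxt⟩
    have hP : PathIn (openGraph ω) (↑(box d n) : Set (Site d)) x t :=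
      pathIn_map (f := id) (fun a ha => ha) (fun a b _ _ hab => by
        rw [openGraph_adj] at hab ⊢; exact ⟨hab.1.1, hab.2⟩) (pathIn_of_mem_openConnIn hxt)
    have hQ : PathIn (openGraph ω) (↑(box d n) : Set (Site d)) 0 x :=
      pathIn_map (f := id) (fun a ha => hVn ha) (fun a b _ _ hab => hab) (pathIn_of_mem_openConnIn (hconn x hx))
    exact ⟨t, ht, mem_openConnIn_of_pathIn (hQ.trans hP)⟩

/-- **THE LAW OF THE CLUSTER OF THE ORIGIN IN A BOX UNDER THE IIC IS THE `P_p`-LAW TILTED BY THE IIC CAPACITY.**  Let `V ∋ 0`, `V ⊆ Λ(m)`, be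
connected through the set `G` of its internal lattice edges, `F` = the pairs from `V` to `Λ(m) ∖ V`, `CL_m(V) = {F closed} ∩ {0 ↔ v inside V, ∀ v ∈ V}`
('the open cluster of `0` in `Λ(m)` is `V`'), and `C = {F closed, G open}`.  For every measure `ν` with Kesten's IIC limit property at `p`:
**`ν(CL_m(V)) · P_p(C) = P_p(CL_m(V)) · ν(C)`**, i.e. `ν(CL_m(V)) = P_p(CL_m(V)) · c_m(V)` with the IIC CAPACITY `c_m(V) = ν(C)/P_p(C) =
lim_n P_p(V ↔ ∂ⁱⁿΛ(n) using no pair at V inside Λ(m))/π_p(n)` — the Radon–Nikodym density of the `ν`-law of the cluster pattern against its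
`P_p`-law depends on the pattern only through this capacity. [cite: Kesten1986, Thm. (3) and §2 (2.16)] [cite: BasuSapozhnikov2017ECP, Thm. 1.1] -/
theorem iicMeasure_real_clusterBox_mul_eq (p : unitInterval) {ν : Measure (BondConfig (Site d))}
    (hν : ∀ (F : Finset (Sym2 (Site d))) (E : Set (BondConfig (Site d))), MeasurableSet E → DeterminedBy E ↑F →
      Tendsto (fun n : ℕ => (bondPercolation (zdGraph d) p).real (E ∩ siteToBoundary d n) / oneArmProb d p n)
        atTop (𝓝 (ν.real E)))
    {m : ℕ} {V : Finset (Site d)} (hVm : V ⊆ box d m) (h0 : (0 : Site d) ∈ V)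
    {F G : Finset (Sym2 (Site d))} (hF : ∀ e, e ∈ F ↔ ∃ a ∈ V, ∃ b ∈ box d m, b ∉ V ∧ e = s(a, b))
    (hG : ∀ e ∈ G, ∀ v ∈ e, v ∈ V) (hVconn : ∀ v ∈ V, PathIn (openGraph (↑G : Set (Sym2 (Site d)))) (↑V : Set (Site d)) 0 v) :
    ν.real ({ω : BondConfig (Site d) | ∀ e ∈ F, e ∉ ω} ∩ {ω | ∀ v ∈ V, ω ∈ openConnIn (↑V : Set (Site d)) 0 v}) *
        (bondPercolation (zdGraph d) p).real {ω : BondConfig (Site d) | (∀ e ∈ F, e ∉ ω) ∧ ∀ e ∈ G, e ∈ ω} =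
      (bondPercolation (zdGraph d) p).real ({ω : BondConfig (Site d) | ∀ e ∈ F, e ∉ ω} ∩
          {ω | ∀ v ∈ V, ω ∈ openConnIn (↑V : Set (Site d)) 0 v}) *
        ν.real {ω : BondConfig (Site d) | (∀ e ∈ F, e ∉ ω) ∧ ∀ e ∈ G, e ∈ ω} := by
  classical
  set μ := bondPercolation (zdGraph d) p with hμ
  set CL := ({ω : BondConfig (Site d) | ∀ e ∈ F, e ∉ ω} ∩ {ω | ∀ v ∈ V, ω ∈ openConnIn (↑V : Set (Site d)) 0 v}) with hCLdef
  set C := {ω : BondConfig (Site d) | (∀ e ∈ F, e ∉ ω) ∧ ∀ e ∈ G, e ∈ ω} with hCdef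
  -- `CL` is a cylinder on `F ∪ V.sym2`
  have hCLdet : DeterminedBy CL (↑(F ∪ V.sym2) : Set (Sym2 (Site d))) := by
    rw [Finset.coe_union]
    refine (determinedBy_forall_notMem F).mono Set.subset_union_left |>.inter ?_
    have h : {ω : BondConfig (Site d) | ∀ v ∈ V, ω ∈ openConnIn (↑V : Set (Site d)) 0 v} = ⋂ v ∈ V, openConnIn (↑V : Set (Site d)) 0 v := by
      ext ω; simp only [Set.mem_setOf_eq, Set.mem_iInter]
    rw [h, determinedBy_iff]
    intro ω ω' hωω'
    simp only [Set.mem_iInter]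
    refine forall₂_congr fun v _ => ?_
    have hdet := determinedBy_openConnIn (↑V : Set (Site d)) (0 : Site d) v (K := (↑F : Set (Sym2 (Site d))) ∪ ↑V.sym2)
      (by rw [Finset.coe_sym2]; exact Set.subset_union_right)
    exact (determinedBy_iff _ _).1 hdet ω ω' hωω'
  have hCLm : MeasurableSet CL := hCLdet.measurableSet_of_finset
  -- trivial case `P(C) = 0`
  by_cases hC : μ.real C = 0
  · have hνC : ν.real C = 0 := by
      have hlim := hν (F ∪ G) C (determinedBy_cyl F G).measurableSet_of_finset (determinedBy_cyl F G)
      refine tendsto_nhds_unique hlim (tendsto_const_nhds.congr' (Eventually.of_forall fun n => ?_))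
      have h0 : μ.real (C ∩ siteToBoundary d n) = 0 :=
        le_antisymm ((measureReal_mono Set.inter_subset_left (measure_ne_top μ _)).trans hC.le) measureReal_nonneg
      simp only [h0, zero_div]
    rw [hC, hνC, mul_zero, mul_zero]
  have hCpos : 0 < μ.real C := lt_of_le_of_ne measureReal_nonneg (Ne.symm hC)
  -- the limit `P(CONN_F(V;n))/π(n) → ν(C)/P(C)`
  have hconn := tendsto_real_connOff_div_oneArmProb p hν hG h0 hVconn hVm hCpos (F := F)
  -- `ν(CL) = lim P(CL ∩ A_n)/π(n) = lim P(CL)·P(CONN_F(V;n))/π(n)`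
  have hlimCL := hν (F ∪ V.sym2) CL hCLm hCLdet
  have hlim2 : Tendsto (fun n : ℕ => μ.real (CL ∩ siteToBoundary d n) / oneArmProb d p n) atTop (𝓝 (μ.real CL * (ν.real C / μ.real C))) := by
    refine (hconn.const_mul (μ.real CL)).congr' ?_
    filter_upwards [eventually_gt_atTop m] with n hn
    rw [← mul_div_assoc]
    congr 1
    rw [clusterBox_inter_siteToBoundary_eq hn hVm h0 hF, ← connOff_union_eq_connOff (F := F) (S := V.sym2)
      (fun e he v hv => by rw [Finset.mem_sym2_iff] at he; exact he v hv) n]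
    have hdet2 := determinedBy_connOff V (F ∪ V.sym2) n
    exact (bondPercolation_real_inter_of_disjoint (zdGraph d) p disjoint_compl_right hCLdet hdet2 hCLm
      (measurableSet_connOff V (F ∪ V.sym2) n)).symm
  have heq := tendsto_nhds_unique hlimCL hlim2
  rw [heq, mul_assoc, div_mul_cancel₀ _ hC]

end Summit.CriticalPhenomena.PercolationContinuityZ3.Theorems.Crossing
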